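import Mathlib
import HarnessLib

/-!
# The congruence lattice `{w ∈ ℤ² : D ∣ v₁ w₁ + v₂ w₂}`: determinants, parallel vectors, box gauge

Elementary facts about the rank-two lattice `Λ = {(w₁, w₂) ∈ ℤ² : v₁ w₁ + v₂ w₂ ≡ 0 (mod D)}`
(`CongruenceLattice.InL`), used in `CongruenceLatticeBoxCount` to count its primitive points in
a box (the geometry-of-numbers input of [Bernert2025, Prop. 2] and
[BernertEtAl2024, Prop. 3.2 (arXiv v1)] for the bounds on `N_λ(X)` of
`Literature.NumberTheory.DiophantineGeometry.AbcExceptionalSetBounds`):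

* `CongruenceLattice.dvd_det2` — `D ∣ det(p, q)` for `p, q ∈ Λ` when `gcd(v₁, v₂, D) = 1`
  (cofactor expansion and a Bézout relation);
* `CongruenceLattice.exists_gcd_mul_eq_of_det2_eq_zero` — a vector `r` with `det(b, r) = 0`,
  `b ≠ 0`, satisfies `gcd(b₁, b₂) r = t b` for an integer `t`;
* the box gauge `φ(w) = max(|w₁| N₂, |w₂| N₁)` (`CongruenceLattice.gauge`), its homogeneity and
  subadditivity.

## References

* [Bernert2025] C. Bernert, *The exceptional set in the abc conjecture*, arXiv:2506.13364 (2025),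
  proof of Proposition 2 ("basic geometry of numbers").
* [BernertEtAl2024] C. Bernert, T. Browning, J. D. Lichtman, J. Teräväinen, *Bounds on the
  exceptional set in the abc conjecture*, arXiv:2410.12234, proof of Proposition 3.2 (v1).
-/

noncomputable section

open Finset

namespace Literature.NumberTheory.DiophantineGeometry

namespace CongruenceLattice

/-! ### The congruence lattice `Λ = {w : D ∣ v₁ w₁ + v₂ w₂}` and `2 × 2` determinants -/

/-- Membership in `Λ = {w ∈ ℤ² : D ∣ v₁ w₁ + v₂ w₂}`. [folklore] -/
def InL (D : ℕ) (v₁ v₂ : ℤ) (w : ℤ × ℤ) : Prop :=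
  (D : ℤ) ∣ v₁ * w.1 + v₂ * w.2

/-- The `2 × 2` determinant `det(b, p) = b₁ p₂ - b₂ p₁`. [folklore] -/
def det2 (b p : ℤ × ℤ) : ℤ :=
  b.1 * p.2 - b.2 * p.1

/-- `Λ` is closed under `r - q • b`. [folklore] -/
theorem InL.sub_smul {D : ℕ} {v₁ v₂ : ℤ} {r b : ℤ × ℤ} (hr : InL D v₁ v₂ r)
    (hb : InL D v₁ v₂ b) (q : ℤ) : InL D v₁ v₂ (r.1 - q * b.1, r.2 - q * b.2) := by
  obtain ⟨kr, hkr⟩ := hr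
  obtain ⟨kb, hkb⟩ := hb
  exact ⟨kr - q * kb, by simp only; linear_combination hkr - q * hkb⟩

/-- For `p, q ∈ Λ` one has `D ∣ det(p, q)` when `gcd(v₁, v₂, D) = 1` (cofactor expansion and a
Bézout relation). [folklore] -/
theorem dvd_det2 {D : ℕ} {v₁ v₂ : ℤ} (hv : Nat.Coprime (Int.gcd v₁ v₂) D) {p q : ℤ × ℤ}
    (hp : InL D v₁ v₂ p) (hq : InL D v₁ v₂ q) : (D : ℤ) ∣ det2 p q := by
  obtain ⟨kp, hkp⟩ := hp
  obtain ⟨kq, hkq⟩ := hq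
  obtain ⟨a, c, hac⟩ := Nat.isCoprime_iff_coprime.mpr hv
  rw [Int.gcd_eq_gcd_ab v₁ v₂] at hac
  set x := Int.gcdA v₁ v₂
  set y := Int.gcdB v₁ v₂
  refine ⟨a * x * (q.2 * kp - p.2 * kq) + a * y * (p.1 * kq - q.1 * kp) + c * det2 p q, ?_⟩
  unfold det2
  linear_combination (a * (x * q.2 - y * q.1)) * hkp + (a * (y * p.1 - x * p.2)) * hkq +
    (-(p.1 * q.2 - p.2 * q.1)) * hac

/-- A vector parallel to `b ≠ 0` is a multiple of `b / gcd(b₁, b₂)`: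
`det(b, r) = 0 ⟹ gcd(b₁, b₂) · r = t · b` for an integer `t`. [folklore] -/
theorem exists_gcd_mul_eq_of_det2_eq_zero {b r : ℤ × ℤ} (hb : b ≠ 0) (h : det2 b r = 0) :
    ∃ t : ℤ, (Int.gcd b.1 b.2 : ℤ) * r.1 = t * b.1 ∧ (Int.gcd b.1 b.2 : ℤ) * r.2 = t * b.2 := by
  have hg : 0 < Int.gcd b.1 b.2 := by
    refine Int.gcd_pos_iff.mpr ?_
    by_contra hcon
    push Not at hcon
    exact hb (Prod.ext hcon.1 hcon.2)
  obtain ⟨b₁', b₂', hcop, hb₁, hb₂⟩ := Int.exists_gcd_one hg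
  set g : ℤ := (Int.gcd b.1 b.2 : ℤ) with hgdef
  have hg0 : g ≠ 0 := by rw [hgdef]; exact_mod_cast hg.ne'
  have h' : b₁' * r.2 = b₂' * r.1 := by
    have h1 : g * (b₁' * r.2 - b₂' * r.1) = 0 := by
      unfold det2 at h; rw [hb₁, hb₂] at h; linear_combination h
    rcases mul_eq_zero.mp h1 with h2 | h2
    · exact absurd h2 hg0
    · linarith
  rcases eq_or_ne b₁' 0 with h0 | h0
  · -- `b₁ = 0`, `b₂' = ±1`
    have hu : b₂' * b₂' = 1 := by
      have h1 : Int.gcd 0 b₂' = 1 := by rwa [h0] at hcop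
      rw [Int.gcd_zero_left] at h1
      have h2 : b₂' = 1 ∨ b₂' = -1 := Int.natAbs_eq_natAbs_iff.mp (by simpa using h1)
      rcases h2 with h2 | h2 <;> rw [h2] <;> norm_num
    have hr1 : r.1 = 0 := by
      have h1 : b₂' * r.1 = 0 := by rw [← h', h0, zero_mul]
      rcases mul_eq_zero.mp h1 with h2 | h2
      · rw [h2] at hu; norm_num at hu
      · exact h2
    refine ⟨r.2 * b₂', ?_, ?_⟩
    · rw [hr1, hb₁, h0]; ring
    · rw [hb₂]; linear_combination (-(g * r.2)) * hu
  · -- `b₁' ≠ 0`: `b₁' ∣ r₁`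
    have hdvd : b₁' ∣ r.1 :=
      Int.dvd_of_dvd_mul_right_of_gcd_one (Dvd.intro _ h') hcop
    obtain ⟨t, ht⟩ := hdvd
    have hr2 : r.2 = b₂' * t := by
      have h1 : b₁' * r.2 = b₁' * (b₂' * t) := by rw [h', ht]; ring
      exact mul_left_cancel₀ h0 h1
    refine ⟨t, ?_, ?_⟩
    · rw [ht, hb₁]; ring
    · rw [hr2, hb₂]; ring

/-! ### The gauge `φ(w) = max(|w₁| N₂, |w₂| N₁)` -/

/-- The box gauge `φ(w) = max(|w₁| N₂, |w₂| N₁)` (`φ(w) ≤ N₁N₂` exactly on the box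
`|w₁| ≤ N₁, |w₂| ≤ N₂` when `N₁, N₂ ≥ 1`). [folklore] -/
def gauge (N₁ N₂ : ℕ) (w : ℤ × ℤ) : ℕ :=
  max (w.1.natAbs * N₂) (w.2.natAbs * N₁)

/-- `φ` is homogeneous: `φ(k w) = |k| φ(w)`. [folklore] -/
theorem gauge_mul (N₁ N₂ : ℕ) (k : ℤ) (w : ℤ × ℤ) :
    gauge N₁ N₂ (k * w.1, k * w.2) = k.natAbs * gauge N₁ N₂ w := by
  unfold gauge
  simp only [Int.natAbs_mul, mul_assoc]
  rcases le_total (w.1.natAbs * N₂) (w.2.natAbs * N₁) with h | h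
  · rw [max_eq_right h, max_eq_right (Nat.mul_le_mul_left _ h)]
  · rw [max_eq_left h, max_eq_left (Nat.mul_le_mul_left _ h)]

/-- `φ` is subadditive (for differences): `φ(p - q) ≤ φ(p) + φ(q)`. [folklore] -/
theorem gauge_sub_le (N₁ N₂ : ℕ) (p q : ℤ × ℤ) :
    gauge N₁ N₂ (p.1 - q.1, p.2 - q.2) ≤ gauge N₁ N₂ p + gauge N₁ N₂ q := by
  unfold gauge
  have h1 : (p.1 - q.1).natAbs * N₂ ≤ p.1.natAbs * N₂ + q.1.natAbs * N₂ := by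
    rw [← add_mul]; exact Nat.mul_le_mul_right _ (Int.natAbs_sub_le _ _)
  have h2 : (p.2 - q.2).natAbs * N₁ ≤ p.2.natAbs * N₁ + q.2.natAbs * N₁ := by
    rw [← add_mul]; exact Nat.mul_le_mul_right _ (Int.natAbs_sub_le _ _)
  refine max_le ?_ ?_
  · exact h1.trans (add_le_add (le_max_left _ _) (le_max_left _ _))
  · exact h2.trans (add_le_add (le_max_right _ _) (le_max_right _ _))

end CongruenceLattice

end Literature.NumberTheory.DiophantineGeometry
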